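import Summits.Ventures.PercRepro.S2DichotomyTools
import Summits.Ventures.PercRepro.S2TailCell
import Summits.Ventures.PercRepro.S2SpanningCount
import Summits.Ventures.PercRepro.S2FlatCountTwo
import Summits.Ventures.PercRepro.S2PhiFourteenFive
import Summits.Ventures.PercRepro.S2CapFree
import Summits.Ventures.PercRepro.TriangleCapEightI
import Summits.Ventures.PercRepro.S1CoreCapSevenFinal
import Summits.Ventures.PercRepro.S1FiveCircuitBase
import Summits.Ventures.PercRepro.S2TopGraded
import Summits.Ventures.PercRepro.S2MaxExtension
import Summits.Ventures.PercRepro.S2FlatCountTwoSharp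
import Summits.Ventures.PercRepro.S2CountsCell
import Summits.Ventures.PercRepro.S2SpreadTail
import Summits.Ventures.PercRepro.S2FlatSharp
import Summits.Ventures.PercRepro.S2BasesTriangles
import Summits.Ventures.PercRepro.RankLevelSetFourCircuitNullityFour

/-!
# PercRepro — S2: THE SCALED CELL `(12, 7)` (STANDARD CAPS) AT `K₂ = 14474` (p7, gen 14; sub-claim S2; the `p = 14` row)

The second coloop step of the cell `(14, 7)`: on `(M ＼ {e}) ＼ {f}` (an `e`-free core of rank `12` on `19` points) the weighted inequality
`(Φ(14,5) − 6)/4 · #U(12, 5) ≤ mid(12, 5)` by the nested dichotomy with the concentrated tail and the sharp spread count (`gencellg7.py`).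
**`ThmN.c025_twelve_seven_k2`**. Axioms: standard.
-/

open scoped Matroid

namespace PercRepro

namespace ThmN

open Set

variable {α : Type}

/-- The standard caps at `(12, 7)`: `s₃ ≤ 11` (`TriangleCap.cq3 7`), `s₄ ≤ 64` (`S1.avgBoundSeven 0`, the `Q*(7) = 19` chain), `s₅ ≤ 401` (`S1.avgChain5b 7`) on every `e`-free core of nullity `7`. -/
theorem caps_twelve_seven_k2 (M : Matroid α) [M.Finite]
    (hd : M.E.encard = M.eRank + ((7 : ℕ) : ℕ∞))
    (hfree : ∀ e ∈ M.E, ∃ A ⊆ M.E \ {e}, e ∉ M.closure A ∧ e ∉ M.closure ((M.E \ {e}) \ A)) :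
    {C : Set α | M.IsCircuit C ∧ C.ncard = 3}.ncard ≤ 11 ∧
      {C : Set α | M.IsCircuit C ∧ C.ncard = 4}.ncard ≤ 64 ∧
        {C : Set α | M.IsCircuit C ∧ C.ncard = 5}.ncard ≤ 401 := by
  have hs3 := TriangleCap.core_ncard_triangles_le_cq3 M hfree hd
  rw [show TriangleCap.cq3 7 = 11 by decide] at hs3
  have hs4 := S1.ncard_fourCircuits_le_avgBoundSeven 0 M hfree (by convert hd using 2; norm_num)
  rw [show S1.avgBoundSeven 0 = 64 by decide] at hs4
  have hs5 := S1.ncard_fiveCircuits_le_avgChain5b 7 M hfree hd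
  rw [show S1.avgChain5b 7 = 401 by decide] at hs5
  exact ⟨hs3, hs4, hs5⟩

/-- The tail side of the cell `(12, 7)` on the caps `11 / 64 / 401` with the spanning count `S` a parameter: the rank-`≤ 5` part
of the kit's tail is exactly `6628297598 / 74025 = 89,541.3`, so `1024·(T + S) ≤ m·2^19` whenever `1024·(6628297598 / 74025 + S) ≤ m·2^19`. -/
theorem tail_twelve_seven_k2 (S m : ℕ) (h : (1024 : ℚ) * ((6628297598 / 74025 : ℚ) + (S : ℚ)) ≤ (m : ℚ) * 2 ^ 19) :
    1024 * ((((12 + 7).choose 4 : ℚ) +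
      (∑ j ∈ Finset.range 6, (Nat.choose (min 5 ((7 + 3) / 2 + 1 - 2)) j : ℚ) / (((j + 1) + 3 * (j + 1).choose 2 + 3 * (j + 1).choose 3 + 2 * (j + 1).choose 4 : ℕ) : ℚ)) *
        ((11 * (12 + 7 - 3).choose 2 + 64 * (12 + 7 - 4) + 401 : ℕ) : ℚ) +
      ((∑ j ∈ Finset.range 6, (Nat.choose 5 j : ℚ) / (((j + 1) + 3 * (j + 1).choose 2 + 3 * (j + 1).choose 3 + 2 * (j + 1).choose 4 : ℕ) : ℚ)) -
        (∑ j ∈ Finset.range 6, (Nat.choose (min 5 ((7 + 3) / 2 + 1 - 2)) j : ℚ) / (((j + 1) + 3 * (j + 1).choose 2 + 3 * (j + 1).choose 3 + 2 * (j + 1).choose 4 : ℕ) : ℚ))) *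
        ((10 : ℕ).choose 5 : ℚ)) +
      (((12 + 7).choose 3 * 2 ^ 3 + (12 + 7).choose 2 * 2 + (12 + 7) + 1 : ℕ) : ℚ) +
      (((12 + 7).choose 5 : ℚ) + (∑ j ∈ Finset.range (7), (Nat.choose (min 13 ((7 + 6) / 2 + 1 - 2)) j : ℚ) / (((j + 1) + 3 * (j + 1).choose 2 + 3 * (j + 1).choose 3 + 2 * (j + 1).choose 4 : ℕ) : ℚ)) * ((11 * (12 + 7 - 3).choose 3 + 64 * (12 + 7 - 4).choose 2 + 401 * (12 + 7 - 5) + (7 + 5).choose 6 : ℕ) : ℚ) +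
        ((∑ j ∈ Finset.range (7), (Nat.choose (min 19 (5 + 7) - 6) j : ℚ) / (((j + 1) + 3 * (j + 1).choose 2 + 3 * (j + 1).choose 3 + 2 * (j + 1).choose 4 : ℕ) : ℚ)) - (∑ j ∈ Finset.range (7), (Nat.choose (min 13 ((7 + 6) / 2 + 1 - 2)) j : ℚ) / (((j + 1) + 3 * (j + 1).choose 2 + 3 * (j + 1).choose 3 + 2 * (j + 1).choose 4 : ℕ) : ℚ))) *
        ((min 19 (5 + 7)).choose 6 : ℚ)) +
      (S : ℚ)) ≤ (m : ℚ) * 2 ^ (12 + 7) := by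
  have hsm : (∑ j ∈ Finset.range (7), (Nat.choose (min 13 ((7 + 6) / 2 + 1 - 2)) j : ℚ) / (((j + 1) + 3 * (j + 1).choose 2 + 3 * (j + 1).choose 3 + 2 * (j + 1).choose 4 : ℕ) : ℚ)) = 12767 / 4230 := by
    norm_num [Finset.sum_range_succ, Nat.choose]
  have hsg : (∑ j ∈ Finset.range (7), (Nat.choose (min 19 (5 + 7) - 6) j : ℚ) / (((j + 1) + 3 * (j + 1).choose 2 + 3 * (j + 1).choose 3 + 2 * (j + 1).choose 4 : ℕ) : ℚ)) = 414767 / 103635 := by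
    norm_num [Finset.sum_range_succ, Nat.choose]
  have hs4m : (∑ j ∈ Finset.range 6, (Nat.choose (min 5 ((7 + 3) / 2 + 1 - 2)) j : ℚ) / (((j + 1) + 3 * (j + 1).choose 2 + 3 * (j + 1).choose 3 + 2 * (j + 1).choose 4 : ℕ) : ℚ)) = 523 / 225 := by
    norm_num [Finset.sum_range_succ, Nat.choose]
  have hs4g : (∑ j ∈ Finset.range 6, (Nat.choose 5 j : ℚ) / (((j + 1) + 3 * (j + 1).choose 2 + 3 * (j + 1).choose 3 + 2 * (j + 1).choose 4 : ℕ) : ℚ)) = 12767 / 4230 := by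
    norm_num [Finset.sum_range_succ, Nat.choose]
  rw [hsm, hsg, hs4m, hs4g]
  norm_num [Nat.choose] at h ⊢
  linarith

/-- the weights of the case `ν = 4`: `σ_m = 8 / 5`, `σ_g = 8 / 5`. -/
theorem sig_twelve_seven_k2_4_m : (∑ j ∈ Finset.range (7 - 5), (Nat.choose (min (9 - 6) ((7 + 6) / 2 + 1 - 2)) j : ℚ) / (((j + 1) + 3 * (j + 1).choose 2 + 3 * (j + 1).choose 3 + 2 * (j + 1).choose 4 : ℕ) : ℚ)) = 8 / 5 := by
  norm_num [Finset.sum_range_succ, Nat.choose]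

/-- the weights of the case `ν = 4`, the giant term. -/
theorem sig_twelve_seven_k2_4_g : (∑ j ∈ Finset.range (7 - 5), (Nat.choose (min 9 (5 + 7) - 6) j : ℚ) / (((j + 1) + 3 * (j + 1).choose 2 + 3 * (j + 1).choose 3 + 2 * (j + 1).choose 4 : ℕ) : ℚ)) = 8 / 5 := by
  norm_num [Finset.sum_range_succ, Nat.choose]

/-- **The cell `(12, 7)` by the nested dichotomy with the concentrated tail**: `RLS M 12 5` on every `e`-free core of rank `12` on `19`
points (standard caps `11 / 64 / 401`, `((phiK 14 5 - 6) / 4) ≤ 2^17/14474`; the cases `ν = 6, …, 4` on `≤ 11, …, 9` points each with its own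
spanning count and slack (`full` / `pay` / `flat` / `graded` = the graded partition count), then spread with the kit's tail, slack `359/1024`). -/
theorem c025_twelve_seven_k2 (M : Matroid α) [M.Finite]
    (hR : M.eRank = ((12 : ℕ) : ℕ∞)) (hn : M.E.ncard = 12 + 7)
    (hfree : ∀ e ∈ M.E, ∃ A ⊆ M.E \ {e}, e ∉ M.closure A ∧ e ∉ M.closure ((M.E \ {e}) \ A)) :
    ((phiK 14 5 - 6) / 4) * (Matroid.topCount M 12 5 : ℚ) ≤ (Matroid.midCount M 12 5 : ℚ) := by
  classical
  have hd : M.E.encard = M.eRank + ((7 : ℕ) : ℕ∞) := by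
    rw [hR, ← M.ground_finite.cast_ncard_eq, hn]
    push_cast
    ring
  obtain ⟨hs3, hs4, hs5⟩ := caps_twelve_seven_k2 M hd hfree
  have full : ∀ (k : ℕ) {W : Set α}, W ⊆ M.E → W.encard = M.eRk W + k →
      Matroid.topCount M 12 5 ≤ ∑ m ∈ Finset.Icc 5 7, ∑ j ∈ Finset.Icc (m + k - 7) m,
        W.ncard.choose j * (12 + 7 - W.ncard).choose (m - j) := by
    intro k W hW hWk
    refine (S2.topCount_le_sum_spanning M hR hd 5).trans ?_
    refine Finset.sum_le_sum (fun m _ => ?_)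
    have h := S2.ncard_spanning_compl_le_of_nullity M hW hd hWk (m := m)
    rw [hn] at h
    exact h
  have span : ∀ (k : ℕ) {W : Set α}, W ⊆ M.E → W.encard = M.eRk W + k →
      {X : Set α | X ⊆ M.E ∧ M.eRk X = M.eRank}.ncard ≤ ∑ m ∈ Finset.range (7 + 1), ∑ j ∈ Finset.Icc (m + k - 7) m,
        W.ncard.choose j * (12 + 7 - W.ncard).choose (m - j) := by
    intro k W hW hWk
    have h := S2.ncard_spanning_le_of_nullity M hW hd hWk
    rw [hn] at h
    exact h
  have cell : ∀ (U S m : ℕ), Matroid.topCount M 12 5 ≤ U → {X : Set α | X ⊆ M.E ∧ M.eRk X = M.eRank}.ncard ≤ S → m ≤ 1024 →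
      1024 * (U : ℚ) ≤ ((1024 - m : ℕ) : ℚ) * 2 ^ (7 - 5) * (14474 : ℚ) →
      (1024 : ℚ) * ((6628297598 / 74025 : ℚ) + (S : ℚ)) ≤ (m : ℚ) * 2 ^ 19 → ((phiK 14 5 - 6) / 4) * (Matroid.topCount M 12 5 : ℚ) ≤ (Matroid.midCount M 12 5 : ℚ) := by
    intro U S m hU hS hm hpoly htail
    exact c025_core_five_cell_of_topCount_spanning_xqictq5g M 12 7 (by norm_num) hR hn hfree 11 64 401 hs3 hs4 hs5 U hU S hS
      14474 (by norm_num) (((phiK 14 5 - 6) / 4)) (by rw [S2.phiK_fourteen_five]; norm_num) ⟨m, hm, hpoly, tail_twelve_seven_k2 S m htail⟩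
  have cellA : ∀ (U S m : ℕ) (A : ℚ), Matroid.topCount M 12 5 ≤ U → ({X : Set α | X ⊆ M.E ∧ M.eRk X ≤ 5}.ncard : ℚ) ≤ A → {X : Set α | X ⊆ M.E ∧ M.eRk X = M.eRank}.ncard ≤ S → m ≤ 1024 →
      1024 * (U : ℚ) ≤ ((1024 - m : ℕ) : ℚ) * 2 ^ (7 - 5) * (14474 : ℚ) →
      (1024 : ℚ) * (A + (S : ℚ)) ≤ (m : ℚ) * 2 ^ 19 → ((phiK 14 5 - 6) / 4) * (Matroid.topCount M 12 5 : ℚ) ≤ (Matroid.midCount M 12 5 : ℚ) := by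
    intro U S m A hU hA hS hm hpoly htail
    exact c025_core_five_cell_of_counts_xqictq5g M 12 7 (by norm_num) hR hn U hU A hA S hS
      14474 (by norm_num) (((phiK 14 5 - 6) / 4)) (by rw [S2.phiK_fourteen_five]; norm_num) ⟨m, hm, hpoly, htail⟩
  by_cases h6 : ∃ W ⊆ M.E, W.ncard ≤ 11 ∧ W.encard = M.eRk W + 6
  · obtain ⟨W, hW, hWn, hWk⟩ := h6
    have hU' : Matroid.topCount M 12 5 ≤ 11286 := by
      refine (full 6 hW hWk).trans ?_
      generalize W.ncard = w at hWn ⊢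
      interval_cases w <;> decide
    have hS' : {X : Set α | X ⊆ M.E ∧ M.eRk X = M.eRank}.ncard ≤ 13704 := by
      refine (span 6 hW hWk).trans ?_
      generalize W.ncard = w at hWn ⊢
      interval_cases w <;> decide
    exact cell 11286 13704 202 hU' hS' (by norm_num) (by norm_num) (by norm_num)
  by_cases h5 : ∃ W ⊆ M.E, W.ncard ≤ 10 ∧ W.encard = M.eRk W + 5
  · obtain ⟨W, hW, hWn, hWk⟩ := h5
    have hU' : Matroid.topCount M 12 5 ≤ 27582 := by
      refine (full 5 hW hWk).trans ?_
      generalize W.ncard = w at hWn ⊢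
      interval_cases w <;> decide
    have hS' : {X : Set α | X ⊆ M.E ∧ M.eRk X = M.eRank}.ncard ≤ 31568 := by
      refine (span 5 hW hWk).trans ?_
      generalize W.ncard = w at hWn ⊢
      interval_cases w <;> decide
    exact cell 27582 31568 237 hU' hS' (by norm_num) (by norm_num) (by norm_num)
  by_cases h4 : ∃ W ⊆ M.E, W.ncard ≤ 9 ∧ W.encard = M.eRk W + 4
  · obtain ⟨W, hW, hWn, hWk⟩ := h4
    have hflat : ∀ X ⊆ M.E, M.eRk X ≤ 5 → X.ncard ≤ 9 := fun X hX hr => by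
      have := S2.ncard_le_of_eRk_le_of_not_nullity M 5 10 (by norm_num) h5 hX (r := 5) (by norm_num) (by exact_mod_cast hr)
      omega
    have hflat' : ∀ X ⊆ M.E, M.eRk X ≤ 4 → X.ncard ≤ 8 := fun X hX hr => by
      have := S2.ncard_le_of_eRk_le_of_not_nullity M 5 10 (by norm_num) h5 hX (r := 4) (by norm_num) (by exact_mod_cast hr)
      omega
    have hV := S2.ncard_spanning_compl_le_of_nullity M hW hd hWk (m := 5)
    have hV' : ∑ j ∈ Finset.Icc (5 + 4 - 7) 5, W.ncard.choose j * (M.E.ncard - W.ncard).choose (5 - j) ≤ 9486 := by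
      rw [hn]
      generalize W.ncard = w at hWn ⊢
      interval_cases w <;> decide
    have hU := topCount_le_payment_flat M 12 7 (by norm_num) hR hn hfree 9 8 hflat hflat' (by norm_num) (by norm_num)
      11 64 401 hs3 hs4 hs5 9486 (hV.trans hV')
    rw [sig_twelve_seven_k2_4_m, sig_twelve_seven_k2_4_g] at hU
    norm_num [Nat.choose] at hU
    have hUq : (Matroid.topCount M 12 5 : ℚ) ≤ 42121 := by linarith
    have hU' : Matroid.topCount M 12 5 ≤ 42121 := by exact_mod_cast hUq
    have hS' : {X : Set α | X ⊆ M.E ∧ M.eRk X = M.eRank}.ncard ≤ 53072 := by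
      refine (span 4 hW hWk).trans ?_
      generalize W.ncard = w at hWn ⊢
      interval_cases w <;> decide
    exact cell 42121 53072 279 hU' hS' (by norm_num) (by norm_num) (by norm_num)
  · -- spread: rank-`5` sets `≤ 8`, rank-`4` sets `≤ 7`; the sharp count with the spread rank part (`≤ 11` triangles against the kit's spanning bound, `≥ 12` against three triangles' Bonferroni)
    have hflat : ∀ X ⊆ M.E, M.eRk X ≤ 5 → X.ncard ≤ 8 := fun X hX hr => by
      have := S2.ncard_le_of_eRk_le_of_not_nullity M 4 9 (by norm_num) h4 hX (r := 5) (by norm_num) (by exact_mod_cast hr)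
      omega
    have hflat' : ∀ X ⊆ M.E, M.eRk X ≤ 4 → X.ncard ≤ 7 := fun X hX hr => by
      have := S2.ncard_le_of_eRk_le_of_not_nullity M 4 9 (by norm_num) h4 hX (r := 4) (by norm_num) (by exact_mod_cast hr)
      omega
    have hEcard : M.ground_finite.toFinset.card = 12 + 7 := by
      rw [← Set.ncard_eq_toFinset_card _ M.ground_finite]; exact hn
    by_cases ht : {C : Set α | M.IsCircuit C ∧ C.ncard = 3}.ncard ≤ 11
    · have hU := topCount_le_flat_sharp M 12 7 (by norm_num) (by norm_num) hR hn hfree 8 7 hflat hflat' (by norm_num) (by norm_num)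
        11 64 401 ht hs4 hs5
      norm_num [Finset.sum_range_succ, Nat.choose] at hU
      have hUq : (Matroid.topCount M 12 5 : ℚ) ≤ 37549 := by linarith
      have hU' : Matroid.topCount M 12 5 ≤ 37549 := by exact_mod_cast hUq
      have hA := ncard_eRk_le_five_le_spread M 12 7 (by norm_num) hR hn hfree hflat hflat' 11 64 401 hs3 hs4 hs5
      have hS := Matroid.ncard_spanning_le (M := M) hd
      rw [hEcard] at hS
      have hS' : {X : Set α | X ⊆ M.E ∧ M.eRk X = M.eRank}.ncard ≤ 94184 := hS.trans (by decide)
      exact cellA 37549 94184 294 _ hU' hA hS' (by norm_num) (by norm_num) (by norm_num [Nat.choose])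
    · push Not at ht
      have hU := topCount_le_flat_sharp M 12 7 (by norm_num) (by norm_num) hR hn hfree 8 7 hflat hflat' (by norm_num) (by norm_num)
        11 64 401 hs3 hs4 hs5
      norm_num [Finset.sum_range_succ, Nat.choose] at hU
      have hUq : (Matroid.topCount M 12 5 : ℚ) ≤ 37549 := by linarith
      have hU' : Matroid.topCount M 12 5 ≤ 37549 := by exact_mod_cast hUq
      have hA := ncard_eRk_le_five_le_spread M 12 7 (by norm_num) hR hn hfree hflat hflat' 11 64 401 hs3 hs4 hs5
      have hL0 : ∀ e ∈ M.E, ¬ M.IsLoop e := not_isLoop_of_free M hfree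
      have hs : ∀ e ∈ M.E, ∀ f ∈ M.E, e ≠ f → M.eRk {e, f} = 2 := by
        intro e he f hf hef
        have h2 : (2 : ℕ∞) ≤ M.eRk {e, f} :=
          two_le_eRk_of_two_le_ncard_of_free M hfree (pair_subset he hf) (by rw [ncard_pair hef])
        have h3 : M.eRk {e, f} ≤ 2 := by
          have := M.eRk_le_encard {e, f}
          rwa [encard_pair hef] at this
        exact le_antisymm h3 h2
      have hC1 : ∀ L ⊆ M.E, M.eRk L = 2 → L.ncard ≤ 3 :=
        fun L hL hr => ncard_le_three_of_eRk_two M hs hfree hL hr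
      have hTfin : {C : Set α | M.IsCircuit C ∧ C.ncard = 3}.Finite :=
        M.ground_finite.finite_subsets.subset (fun C hC => hC.1.subset_ground)
      obtain ⟨T₁, T₂, T₃, hT₁, hT₂, hT₃, h12, h13, h23⟩ := (Set.two_lt_ncard_iff hTfin).1 (by omega)
      have hS := S2.ncard_spanning_add_le_of_three_triangles M hR hn (by norm_num) hC1 hT₁.1 hT₁.2 hT₂.1 hT₂.2 hT₃.1 hT₃.2 h12 h13 h23
      norm_num [Finset.sum_range_succ, Nat.choose] at hS
      have hS' : {X : Set α | X ⊆ M.E ∧ M.eRk X = M.eRank}.ncard ≤ 70160 := by omega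
      exact cellA 37549 70160 247 _ hU' hA hS' (by norm_num) (by norm_num) (by norm_num [Nat.choose])

end ThmN

end PercRepro
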